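import Mathlib
import Summits.Ventures.PercRepro2.HCov
import Summits.Ventures.PercRepro2.BHKMixed

/-!
# Two increasing events of `C_t` are positively correlated given `C_s ↮ X` (blind cell PercRepro2,
night-1 g29; proofs/NIGHT1-G29.md §5.4)

BHK06 Thm 1.3 speaks of the cluster whose avoidance is conditioned on; this file is the companion for
the OTHER cluster: for `t ∈ X` and up-sets `𝓤, 𝓥`,

  `P(C_t ∈ 𝓤, s ↮ X) · P(C_t ∈ 𝓥, s ↮ X) ≤ P(C_t ∈ 𝓤 ∩ 𝓥, s ↮ X) · P(s ↮ X)`   (`same_cluster_other_avoid`).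

Proof (the exploration argument of `bhk_cross_cluster_avoid`): explore `C_s = W`; on `{s ↮ X}` the
cluster of `t` is its cluster in `G ∖ W`, where the two events are increasing, so Harris gives
`g_{𝓤∩𝓥}(W) ≥ g_𝓤(W) g_𝓥(W)` pointwise (`delClusterProb_inter_ge`, from `one_sub_delClusterProb_union`
and inclusion–exclusion), and `g_𝓤, g_𝓥` are antitone in `W`, so `bhk_induced` with `1 − g_𝓤`, `1 − g_𝓥`
(`X = Y`) gives `E[g_𝓤 g_𝓥 1_R] P(R) ≥ E[g_𝓤 1_R] E[g_𝓥 1_R]`.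

Consequence in the two-mark vocabulary (`condH_chain`): under `Q = {a₁ ↮ a₂}`,
`P(Q, v ∉ C₁, o ∈ C₂) · P(Q, v ∉ C₁, v ∈ C₂) ≤ P(Q, v ∉ C₁, o ∈ C₂, v ∈ C₂) · P(Q, v ∉ C₁)`, i.e.
`P(o ∈ C₂ ∣ v ∉ C₁ ∪ C₂) ≤ P(o ∈ C₂ ∣ v ∈ C₂)` — the upper link of the chain
`P(o∈C₂ ∣ v∈C₁) ≤ P(o∈C₂ ∣ v∉U) ≤ P(o∈C₂ ∣ v∈C₂)` whose lower link is `CrossWeighted.cond_cross_avoid`.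
Standard axioms.
-/

namespace Summit.Ventures.PercRepro2

open UnionCluster

namespace OtherClusterAvoid

section Harris

variable {V : Type*} {E : Type*} [Fintype E] [DecidableEq E] [Fintype V] [DecidableEq V]
  {R : Type*} [CommRing R] [LinearOrder R] [IsStrictOrderedRing R]

omit [Fintype V] [DecidableEq V] [LinearOrder R] [IsStrictOrderedRing R] in
/-- Inclusion–exclusion for `delClusterProb`: `g_{𝓦 ∪ 𝓤} + g_{𝓦 ∩ 𝓤} = g_𝓦 + g_𝓤`. -/
lemma delClusterProb_union_add_inter (p : E → R) (ends : E → Sym2 V) (t : V)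
    (𝓦 𝓤 : Set (Set V)) (W : Set V) :
    delClusterProb p ends t (𝓦 ∪ 𝓤) W + delClusterProb p ends t (𝓦 ∩ 𝓤) W =
      delClusterProb p ends t 𝓦 W + delClusterProb p ends t 𝓤 W := by
  unfold delClusterProb
  have h := prob_union_add_prob_inter p {ω : Config E | cluster ends (delConfig ends W ω) t ∈ 𝓦}
    {ω : Config E | cluster ends (delConfig ends W ω) t ∈ 𝓤}
  have e1 : ({ω : Config E | cluster ends (delConfig ends W ω) t ∈ 𝓦} ∪
      {ω : Config E | cluster ends (delConfig ends W ω) t ∈ 𝓤}) =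
      {ω : Config E | cluster ends (delConfig ends W ω) t ∈ 𝓦 ∪ 𝓤} := by
    ext ω; simp only [Set.mem_union, Set.mem_setOf_eq]
  have e2 : ({ω : Config E | cluster ends (delConfig ends W ω) t ∈ 𝓦} ∩
      {ω : Config E | cluster ends (delConfig ends W ω) t ∈ 𝓤}) =
      {ω : Config E | cluster ends (delConfig ends W ω) t ∈ 𝓦 ∩ 𝓤} := by
    ext ω; simp only [Set.mem_inter_iff, Set.mem_setOf_eq]
  rw [e1, e2] at h
  exact h

omit [Fintype V] [DecidableEq V] in
/-- **Harris in `G ∖ W`** for two increasing events of `C_t`: `g_𝓦 · g_𝓤 ≤ g_{𝓦 ∩ 𝓤}` pointwise. -/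
lemma delClusterProb_inter_ge (p : E → R) (hp : IsProbVec p) (ends : E → Sym2 V) (t : V)
    {𝓦 𝓤 : Set (Set V)} (h𝓦 : IsUpperSet 𝓦) (h𝓤 : IsUpperSet 𝓤) (W : Set V) :
    delClusterProb p ends t 𝓦 W * delClusterProb p ends t 𝓤 W ≤
      delClusterProb p ends t (𝓦 ∩ 𝓤) W := by
  have h1 := BHKMixed.one_sub_delClusterProb_union p hp ends t h𝓦 h𝓤 W
  have h2 := delClusterProb_union_add_inter p ends t 𝓦 𝓤 W
  nlinarith [h1, h2]

end Harris

section Main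

variable {V : Type*} {E : Type*} [Fintype E] [DecidableEq E] [Fintype V] [DecidableEq V]
  {R : Type*} [CommRing R] [LinearOrder R] [IsStrictOrderedRing R]

/-- **Two increasing events of `C_t` are positively correlated given `C_s ↮ X`** (`t ∈ X`):
`P(C_t ∈ 𝓤, s↮X) · P(C_t ∈ 𝓥, s↮X) ≤ P(C_t ∈ 𝓤 ∩ 𝓥, s↮X) · P(s↮X)`. -/
theorem same_cluster_other_avoid (p : E → R) (hp : IsProbVec p) (ends : E → Sym2 V) (s t : V)
    {X : Finset V} (ht : t ∈ X) {𝓤 𝓥 : Set (Set V)} (h𝓤 : IsUpperSet 𝓤) (h𝓥 : IsUpperSet 𝓥) :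
    prob p (clusterInEvent ends t 𝓤 ∩ avoidAll ends s X) *
        prob p (clusterInEvent ends t 𝓥 ∩ avoidAll ends s X) ≤
      prob p (clusterInEvent ends t (𝓤 ∩ 𝓥) ∩ avoidAll ends s X) *
        prob p (avoidAll ends s X) := by
  classical
  set g₁ := delClusterProb p ends t 𝓤 with hg₁
  set g₂ := delClusterProb p ends t 𝓥 with hg₂
  set g₁₂ := delClusterProb p ends t (𝓤 ∩ 𝓥) with hg₁₂
  have hg₁_anti : Antitone g₁ := delClusterProb_anti p hp ends t h𝓤
  have hg₂_anti : Antitone g₂ := delClusterProb_anti p hp ends t h𝓥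
  have hg₁1 : ∀ W, g₁ W ≤ 1 := delClusterProb_le_one p hp ends t 𝓤
  have hg₂1 : ∀ W, g₂ W ≤ 1 := delClusterProb_le_one p hp ends t 𝓥
  have hg₁0 : ∀ W, 0 ≤ g₁ W := delClusterProb_nonneg p hp ends t 𝓤
  have hg₂0 : ∀ W, 0 ≤ g₂ W := delClusterProb_nonneg p hp ends t 𝓥
  -- the tower identities (with `Set.univ` for the cluster of `s`)
  have tower : ∀ 𝓔 : Set (Set V), prob p (clusterInEvent ends t 𝓔 ∩ avoidAll ends s X) =
      expect p (fun ω => delClusterProb p ends t 𝓔 (cluster ends ω s) *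
        (avoidAll ends s X).indicator 1 ω) := by
    intro 𝓔
    have e := prob_clusterIn_inter_avoid_eq_expect p ends s t ht Set.univ 𝓔
    simp only [Set.indicator_univ, Pi.one_apply, one_mul] at e
    have e' : clusterInEvent ends s Set.univ ∩ clusterInEvent ends t 𝓔 ∩ avoidAll ends s X =
        clusterInEvent ends t 𝓔 ∩ avoidAll ends s X := by
      ext ω; simp [clusterInEvent]
    rw [e'] at e
    exact e
  have e1 := tower 𝓤
  have e2 := tower 𝓥
  have e12 := tower (𝓤 ∩ 𝓥)
  -- Harris in `G ∖ W`: `E[g₁₂ 1_R] ≥ E[g₁ g₂ 1_R]`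
  have hH : expect p (fun ω => g₁ (cluster ends ω s) * g₂ (cluster ends ω s) *
      (avoidAll ends s X).indicator 1 ω) ≤
      expect p (fun ω => g₁₂ (cluster ends ω s) * (avoidAll ends s X).indicator 1 ω) := by
    refine expect_mono hp fun ω => ?_
    have := delClusterProb_inter_ge p hp ends t h𝓤 h𝓥 (cluster ends ω s)
    have hi : 0 ≤ (avoidAll ends s X).indicator (1 : Config E → R) ω :=
      Set.indicator_apply_nonneg fun _ => zero_le_one
    exact mul_le_mul_of_nonneg_right this hi
  -- the functional same-cluster inequality with `X = Y` for `1 − g₁`, `1 − g₂`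
  have hF₁ : Monotone (fun W => 1 - g₁ W) := fun W W' h => by
    simp only
    linarith [hg₁_anti h]
  have hF₂ : Monotone (fun W => 1 - g₂ W) := fun W W' h => by
    simp only
    linarith [hg₂_anti h]
  have hF₁0 : ∀ W, 0 ≤ 1 - g₁ W := fun W => by linarith [hg₁1 W]
  have hF₂0 : ∀ W, 0 ≤ 1 - g₂ W := fun W => by linarith [hg₂1 W]
  have key := bhk_induced p hp ends s hF₁ hF₂ hF₁0 hF₂0 Finset.univ X X (Finset.subset_univ _)
    (Finset.subset_univ _)
  simp only [Finset.inter_self, Finset.union_self, REvent_univ] at key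
  have e : ∀ F : Set V → R, clusterObs ends Finset.univ s F * (avoidAll ends s X).indicator 1 =
      fun ω => F (cluster ends ω s) * (avoidAll ends s X).indicator 1 ω := by
    intro F
    funext ω
    simp only [Pi.mul_apply, clusterObs_apply, clusterIn_univ]
  rw [e, e, e] at key
  simp only [Pi.mul_apply] at key
  have eR : prob p (avoidAll ends s X) =
      expect p fun ω => (avoidAll ends s X).indicator 1 ω := prob_eq_expect_indicator p _
  have f1 : expect p (fun ω => (1 - g₁ (cluster ends ω s)) * (avoidAll ends s X).indicator 1 ω) =
      prob p (avoidAll ends s X) - prob p (clusterInEvent ends t 𝓤 ∩ avoidAll ends s X) := by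
    rw [e1, eR, ← expect_sub]
    congr 1
    funext ω
    simp only [Pi.sub_apply]
    ring
  have f2 : expect p (fun ω => (1 - g₂ (cluster ends ω s)) * (avoidAll ends s X).indicator 1 ω) =
      prob p (avoidAll ends s X) - prob p (clusterInEvent ends t 𝓥 ∩ avoidAll ends s X) := by
    rw [e2, eR, ← expect_sub]
    congr 1
    funext ω
    simp only [Pi.sub_apply]
    ring
  have f12 : expect p (fun ω => (1 - g₁ (cluster ends ω s)) * (1 - g₂ (cluster ends ω s)) *
      (avoidAll ends s X).indicator 1 ω) =
      prob p (avoidAll ends s X) - prob p (clusterInEvent ends t 𝓤 ∩ avoidAll ends s X) -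
        prob p (clusterInEvent ends t 𝓥 ∩ avoidAll ends s X) +
        expect p (fun ω => g₁ (cluster ends ω s) * g₂ (cluster ends ω s) *
          (avoidAll ends s X).indicator 1 ω) := by
    rw [e1, e2, eR, ← expect_sub, ← expect_sub, ← expect_add]
    congr 1
    funext ω
    simp only [Pi.sub_apply, Pi.add_apply]
    ring
  rw [f1, f2, f12] at key
  rw [e12]
  nlinarith [key, hH, prob_nonneg hp (avoidAll ends s X)]

end Main

section Marks

variable {V : Type*} {E : Type*} [Fintype E] [DecidableEq E] [Fintype V] [DecidableEq V]
  {R : Type*} [CommRing R] [LinearOrder R] [IsStrictOrderedRing R]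

/-- **The upper link of the chain** `P(o ∈ C₂ ∣ v ∉ C₁ ∪ C₂) ≤ P(o ∈ C₂ ∣ v ∈ C₂)` under `a₁ ↮ a₂`, cleared:
with `A = {C(a₁) ∩ {a₂, v} = ∅} = Q ∩ {v ∉ C₁}`,
`P(A, o ∈ C₂) · P(A, v ∈ C₂) ≤ P(A, o ∈ C₂, v ∈ C₂) · P(A)`. -/
theorem condH_chain (p : E → R) (hp : IsProbVec p) (ends : E → Sym2 V) (o a₁ a₂ v : V) :
    prob p (avoidAll ends a₁ {a₂, v} ∩ connEvent ends a₂ o) *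
        prob p (avoidAll ends a₁ {a₂, v} ∩ connEvent ends a₂ v) ≤
      prob p (avoidAll ends a₁ {a₂, v} ∩ connEvent ends a₂ o ∩ connEvent ends a₂ v) *
        prob p (avoidAll ends a₁ {a₂, v}) := by
  classical
  have h := same_cluster_other_avoid p hp ends a₁ a₂ (X := {a₂, v}) (Finset.mem_insert_self a₂ {v})
    (isUpperSet_mem_setOf o) (isUpperSet_mem_setOf v)
  rw [← connEvent_eq_clusterInEvent ends a₂ o, ← connEvent_eq_clusterInEvent ends a₂ v] at h
  have e12 : clusterInEvent ends a₂ ({W : Set V | o ∈ W} ∩ {W : Set V | v ∈ W}) =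
      connEvent ends a₂ o ∩ connEvent ends a₂ v := by
    rw [connEvent_eq_clusterInEvent ends a₂ o, connEvent_eq_clusterInEvent ends a₂ v]
    ext ω; simp [clusterInEvent]
  rw [e12] at h
  have c1 : connEvent ends a₂ o ∩ avoidAll ends a₁ {a₂, v} =
      avoidAll ends a₁ {a₂, v} ∩ connEvent ends a₂ o := Set.inter_comm _ _
  have c2 : connEvent ends a₂ v ∩ avoidAll ends a₁ {a₂, v} =
      avoidAll ends a₁ {a₂, v} ∩ connEvent ends a₂ v := Set.inter_comm _ _
  have c3 : connEvent ends a₂ o ∩ connEvent ends a₂ v ∩ avoidAll ends a₁ {a₂, v} =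
      avoidAll ends a₁ {a₂, v} ∩ connEvent ends a₂ o ∩ connEvent ends a₂ v := by
    ext ω; simp only [Set.mem_inter_iff]; tauto
  rw [c1, c2, c3] at h
  exact h

end Marks

end OtherClusterAvoid

end Summit.Ventures.PercRepro2
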